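import Literature.MathematicalPhysics.QuantumFieldTheory.Balaban1983to89.B9Thm39CubeOpsAtLettersY
import Literature.MathematicalPhysics.QuantumFieldTheory.Balaban1983to89.B9WalkLettersCoordsS

/-!
# `Balaban1983to89.B9Thm39CubeOpsWalkDataY` — [B9] THEOREM 3.9's LOCAL LETTERS OF RECORD: the cube data of `cubeOps39YF` INSTANTIATED by the
# partition of unity and the cubes □̃ of [4] (2.36) at def-Y's member (dag-n06-d's W-a letters `cubeDomY ∕ cubeBlksY ∕ SblkY`, M5.7's `hTY`), the
# static binder `StaticOK39Blk` of rows 15–16's walk PROVED there, and the N06 certificate's `h348` body from the two LOCAL analytic schemas alone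

statement-level skeleton of published theorems with citation tags; proofs where landed; nothing here is a claim about the
Yang–Mills mass gap

T. Bałaban, *Propagators for lattice gauge theories in a background field*, Commun. Math. Phys. **99** (1985) 389–434
[`Balaban1985BackgroundPropagators`, "[B9]"]; [4] = T. Bałaban, *Propagators and renormalization transformations for lattice gauge theories. II*,
Commun. Math. Phys. **96** (1984) 223–250 [`Balaban1984PropagatorsII`].  PDF held (`paper:balaban1985-cmp99-background-propagators`, journal page =
PDF page + 388); pp. 408–411 re-read by this seat (2026-08-28).

THE PRINT (verbatim, p. 408).  *«We take a family 𝒟_j of cubes □, with centers at points of this lattice, which are unions of 2d big blocks, with at least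
one of them contained in B_j(Λ_j). A union of these families for all j is denoted by 𝒟. … We take the partition of unity {h_□} defined at the end of Sect. A
in [4]. We have Σ_{□∈𝒟} h_□² = 1. For a cube □ ∈ 𝒟_j and n = 1, 2, … we define □̃ⁿ as a cube of the size (2 + 2n)ML^jη, and with the same center as □»*;
p. 409 (3.87): *«C₀ = Σ_{□∈𝒟} h_□C_□h_□»*.

WHY THIS FILE (cell context, pub-ymgap N06 DAG).  `B9Thm39CubeOpsAtLettersY` (this lineage, g20) built the multi-cube letter record `cubeOps39YF 𝔏 bI 𝒞 x`
of rows 15–16's Theorem-3.9 road over cube data `𝒞` taken as PARAMETERS, proved its local-inverse identities at every unitary background, and derived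
the certificate's `h348` body from `StaticOK39Blk` + `Local348Blk` + `Small285Blk`.  This file supplies the cube data OF RECORD — dag-n06-d's W-a
walk letters (`B9WalkLettersCoordsS`: `cubeDomY` = □̃ as sites, `cubeBlksY` = □̃ as blocks, `SblkY` = S_□ as index bonds) and M5.7's partition `hTY`
READ ON 𝔅 AT EACH BLOCK's CORNER (print identifies a block y ∈ Λ_j with its label point) — and PROVES the static binder there (`|h_□| ≤ 1`, support,
`Σ_□ h_□² = 1`, `□̃h_□ = h_□`, the member-uniform overlap count, the metric facts), so that rows 15–16's displayed `h348` follows from the two LOCAL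
analytic schemas alone, exactly as rows 18–19's static binders leave the certificate under W-a.

WHAT IS DEFINED ∕ PROVED (sorry-free; one definition with body — the cube data of record `walkCubeData39`).
* ★ `walkCubeData39 bI x : CubeData39 θ M⋆ ↥(cubes …) x := ⟨cubeDomY x, cubeBlksY x, fun c s => hTY … c (blkCornerY s), SblkY x (bI x)⟩`;
  `hDD_walkCubeData39` (sites of the cube's blocks ⊆ the cube's sites — by definition of `cubeDomY`).
* ★★ `staticOK39Blk_cubeOps39YF_walk` — `StaticOK39Blk (cubeOps39YF 𝔏 bI (walkCubeData39 bI) x) walkCntY` for a 1-faithful `bI` above dag-n06-d's threshold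
  `walkCntM₀Y ≤ M`: `hh` ← `abs_hT_le_one`; `hS` ← `rep39F = sIK bI ∘ blkCornerY` + `mem_cubeDomY_of_hTY_ne_zero`; `hpu` ← `sum_hTY_sq`; `hchi` ← `blkOf_blkCornerY`;
  `cnt` ← `sum_indicator_SblkY_le` (up to the `Decidable` instances of the membership tests); geometry ← `geo9Y_dist_triangle ∕ _self`, `geo9K_dist_nonneg'`, `geo9Y_len_pos`.
* ★★★ `display348_of_local348_small285_walk` — the `h348` body `Conv348Blk (oneCubeOps39YF θ M⋆ 𝔏 bI x) (2(walkCntY·B₀)c′) ((1−α′)r) U` at a `G`-valued `U`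
  (`G ≤ U(N)`) from `Local348Blk` and `Small285Blk` at the letters of record ALONE, plus the record's thresholds and [4] Lemma 2.1 (`Ineq261With`).

HONEST SCOPE.  As `B9Thm39CubeOpsAtLettersY`: the two local schemas are the analytic content (Cor. 3.6 at the local operators; [4] (2.83)–(2.85)) and stay
HYPOTHESES; the partition and overlap facts are dag-n06-d's ∕ M5.7's theorems, consumed BY NAME; `h_□` is read at block corners (a modelling choice for
«h_□ on 𝔅», recorded).  Count-neutral (no new named fact; N06 NOT discharged); nothing continuum, nothing about OS axioms or the mass gap.  No `sorry`, no
`axiom`, no `instance`, no `notation`.  Seat `pub-ymgap-dag-n06-j` (bundle F5, rows 15–17), gen 20, 2026-08-28; NEW file; modifies nothing.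
-/

noncomputable section

namespace Literature.MathematicalPhysics.QuantumFieldTheory.Balaban1983to89.B9Thm39CubeOpsWalkDataY

open B9Thm39WholeBlk B9Thm39ReadingAtLetters B9Thm39OneCubeReadingAtLettersY B9Thm39CubeOpsAtLettersY Node00
open B9Ineq349SiteFromConv348 (blk39F)
open B6Lemma21Repaired (Ineq261With)
open B6KLevelCensusIndexV1 B6Geom246MultiLevelBox B9PinMembersKLevelV1 B9PinCarriersKLevelV1 B9PinGeometryKLevelV1 B7Prop2SpecialUnitary

/-! ## §1 The cube letters of record and the static binder as a theorem; §2 the `h348` body from the two local schemas alone -/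

section WalkData

open scoped Matrix.Norms.L2Operator
open B9Thm39ReadingFaithful B6GlobalChartV1 B6Ineq2142KLevelV1
open B6Cover236MultiLevelBlocks (cubes)
open B9Thm37CubeCoverCommutators (hTY sum_hTY_sq)
open B9WalkLettersCoordsS (cubeBlksY cubeDomY SblkY walkCntM₀Y walkCntY walkCntY_nonneg mem_cubeDomY_of_hTY_ne_zero sum_indicator_SblkY_le)
open B9Ineq349SiteFromConv348 (rep39F blkOf_blkCornerY)
open B9CoReadingCoordsS (sIK)
open B6Partition118KLevelTorus (abs_hT_le_one)
open B9BackgroundsKLevelV1R B9GeoLemma21KLevelV1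

variable {N : ℕ} {θ : Stage3Params} {Mstar : ℕ} (𝔏 : LettersY N θ Mstar)
variable [∀ x : MemberY θ.d₆ θ.ℓ₆ θ.hd' θ.hL' θ.b₀ θ.b₁ Mstar, Fintype (geo9Y x).Site]
  [∀ x : MemberY θ.d₆ θ.ℓ₆ θ.hd' θ.hL' θ.b₀ θ.b₁ Mstar, DecidableEq (geo9Y x).Site]
variable (bI : ∀ x : MemberY θ.d₆ θ.ℓ₆ θ.hd' θ.hL' θ.b₀ θ.b₁ Mstar, FBondY x.toKIdx → IBondY x.toKIdx)

/-- ★ **THE CUBE LETTERS OF RECORD**: the cubes `𝒟` of [4] (2.36) at the member (`cubes`), `□̃` as sites (`cubeDomY`) and as blocks (`cubeBlksY`), the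
cut-off `h_□` READ ON 𝔅 AT THE BLOCK's CORNER (print's identification of a block with its label point), and the observation set `S_□ = SblkY`
(dag-n06-d's W-a FILE C-1 `B9WalkLettersCoordsS`). [cite: Balaban1985BackgroundPropagators, p.408 (𝒟, □̃, h_□), (3.87) p.409; Balaban1984PropagatorsII, (2.36) p.229, (2.45) p.231] -/
def walkCubeData39 (x : MemberY θ.d₆ θ.ℓ₆ θ.hd' θ.hL' θ.b₀ θ.b₁ Mstar) : CubeData39 θ Mstar ↥(cubes x.toKIdx.D.toDomains) x where
  D := cubeDomY x
  Dblk := cubeBlksY x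
  hB := fun c s => hTY x.toKIdx c (blkCornerY x.toKIdx s)
  S := SblkY x (bI x)

omit [∀ x : MemberY θ.d₆ θ.ℓ₆ θ.hd' θ.hL' θ.b₀ θ.b₁ Mstar, Fintype (geo9Y x).Site]
  [∀ x : MemberY θ.d₆ θ.ℓ₆ θ.hd' θ.hL' θ.b₀ θ.b₁ Mstar, DecidableEq (geo9Y x).Site] in
/-- the block∕site inclusion `hDD` holds for the letters of record BY DEFINITION of `cubeDomY` (the sites whose block lies in `cubeBlksY`).
[cite: Balaban1985BackgroundPropagators, p.408 (□̃), bookkeeping] -/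
theorem hDD_walkCubeData39 (x : MemberY θ.d₆ θ.ℓ₆ θ.hd' θ.hL' θ.b₀ θ.b₁ Mstar) (c : ↥(cubes x.toKIdx.D.toDomains)) (z : SiteY x.toKIdx)
    (hz : blkOf x.toKIdx.D.toDomains z ∈ (walkCubeData39 bI x).Dblk c) : z ∈ (walkCubeData39 bI x).D c := by
  change z ∈ cubeDomY x c
  unfold cubeDomY
  rw [Finset.mem_filter]
  exact ⟨Finset.mem_univ _, hz⟩

omit [∀ x : MemberY θ.d₆ θ.ℓ₆ θ.hd' θ.hL' θ.b₀ θ.b₁ Mstar, Fintype (geo9Y x).Site] in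
/-- ★★ **THE STATIC BINDER OF ROWS 15–16's WALK IS A THEOREM AT THE LETTERS OF RECORD** (`hst39` discharged): `|h_□| ≤ 1`, `h_□ ≠ 0 ⇒` block `∈ S_□`,
`Σ_□ h_□² = 1`, `□̃h_□ = h_□`, the member-uniform overlap count `Σ_□ 1_{S_□}(y) ≤ walkCntY` (above the threshold `walkCntM₀Y ≤ M`, at a 1-faithful `bI`),
and the metric facts of the record. [cite: Balaban1985BackgroundPropagators, p.408 («Σ h_□² = 1») + (3.87) p.409; Balaban1984PropagatorsII, (2.36) p.229, p.235 («overlap finitely often»), (2.54) p.233] -/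
theorem staticOK39Blk_cubeOps39YF_walk (x : MemberY θ.d₆ θ.ℓ₆ θ.hd' θ.hL' θ.b₀ θ.b₁ Mstar)
    (hβ1 : ∀ f : FBondY x.toKIdx, (B6Geom246MultiLevelTorus.geomT x.D).dist (β x.hN x.D x.hk (bI x f)) (blkV1 x.hN x.D f) ≤ 1)
    (hM : walkCntM₀Y θ.d₆ θ.ℓ₆ θ.hd' θ.hL' θ.b₀ θ.b₁ Mstar ≤ (geo9Y x).M) :
    StaticOK39Blk (cubeOps39YF 𝔏 bI (walkCubeData39 bI) x) (walkCntY θ.d₆ θ.ℓ₆ θ.hd' θ.hL' θ.b₀ θ.b₁ Mstar) where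
  tri := geo9Y_dist_triangle x
  refl := geo9Y_dist_self x
  dnn := geo9K_dist_nonneg' x.toKIdx
  lenpos := geo9Y_len_pos x
  hh := fun c p => abs_hT_le_one x.toKIdx.D (B9Thm37CubeCoverCommutators.one_le_Mh_and_P x.toKIdx).1
    (B9Thm37CubeCoverCommutators.one_le_Mh_and_P x.toKIdx).2 c (blkCornerY x.toKIdx p.1)
  hS := fun c p hp => by
    change rep39F x.toKIdx (bI x) p.1 ∈ SblkY x (bI x) c
    exact Finset.mem_image_of_mem _ (mem_cubeDomY_of_hTY_ne_zero x c hp)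
  hpu := fun p => sum_hTY_sq x.toKIdx (blkCornerY x.toKIdx p.1)
  hchi := fun c p => by
    change blkIndY x.toKIdx (cubeBlksY x c) p.1 * hTY x.toKIdx c (blkCornerY x.toKIdx p.1) = hTY x.toKIdx c (blkCornerY x.toKIdx p.1)
    by_cases h0 : hTY x.toKIdx c (blkCornerY x.toKIdx p.1) = 0
    · rw [h0, mul_zero]
    · have hmem : p.1 ∈ cubeBlksY x c := by
        have hz := mem_cubeDomY_of_hTY_ne_zero x c h0
        unfold cubeDomY at hz
        rw [Finset.mem_filter, blkOf_blkCornerY] at hz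
        exact hz.2
      simp [blkIndY, hmem]
  cnt := fun a => by
    -- the indicator sums agree up to the `Decidable` instances of the membership tests
    refine le_trans (le_of_eq (Finset.sum_congr rfl fun c _ => ?_)) (sum_indicator_SblkY_le x (bI x) hβ1 hM a)
    exact if_congr Iff.rfl rfl rfl

/-- ★★★ **ROWS 15–16 BY PRINT's ROAD WITH THE STATIC BINDER DISCHARGED**: at the letters of record, the displayed `h348` body follows from the two
LOCAL analytic schemas alone — LOCAL (3.48) for the genuine `C_□(U)` and the (2.85)-smallness of (3.95)'s `R` — plus the record's thresholds
(`walkCntM₀Y ≤ M`, `2θ₀c′ ≤ M`), a 1-faithful `bI` and [4] Lemma 2.1. [cite: Balaban1985BackgroundPropagators, (3.95)–(3.96) p.411 + Thm 3.2 (3.48) p.398; Balaban1984PropagatorsII, (2.83)–(2.87) p.238 + Lemma 2.1 (2.61) p.234] -/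
theorem display348_of_local348_small285_walk {G : Subgroup (Matrix (Fin N) (Fin N) ℂ)ˣ}
    (hG : G ≤ B7Prop2Explicit.unitaryUnits (Matrix (Fin N) (Fin N) ℂ)) (x : MemberY θ.d₆ θ.ℓ₆ θ.hd' θ.hL' θ.b₀ θ.b₁ Mstar)
    (hparS : (𝔏 x).parS = parSymY x.toKIdx)
    (hβ1 : ∀ f : FBondY x.toKIdx, (B6Geom246MultiLevelTorus.geomT x.D).dist (β x.hN x.D x.hk (bI x f)) (blkV1 x.hN x.D f) ≤ 1)
    (hMw : walkCntM₀Y θ.d₆ θ.ℓ₆ θ.hd' θ.hL' θ.b₀ θ.b₁ Mstar ≤ (geo9Y x).M)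
    {c' r α' θ₀ B₀ δ₀ : ℝ} (hc' : 0 ≤ c') (hr : 0 ≤ r) (hrδ : r ≤ δ₀) (hα' : α' ≤ 1) (hθ₀ : 0 ≤ θ₀) (hB₀ : 0 ≤ B₀)
    (hM : 0 < (geo9Y x).M) (hMbig : 2 * θ₀ * c' ≤ (geo9Y x).M) (h261 : Ineq261With c' (b6 (geo9Y x)) r α')
    {U : (bg9Y (Matrix (Fin N) (Fin N) ℂ) (specialUnitaryUnits (Fin N)) x).Cfg} (hU : ∀ μ z, U μ z ∈ G)
    (hloc : Local348Blk (cubeOps39YF 𝔏 bI (walkCubeData39 bI) x) B₀ δ₀ U)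
    (hsmall : Small285Blk (cubeOps39YF 𝔏 bI (walkCubeData39 bI) x) θ₀ r U) :
    Conv348Blk (oneCubeOps39YF θ Mstar 𝔏 bI x) (2 * (walkCntY θ.d₆ θ.ℓ₆ θ.hd' θ.hL' θ.b₀ θ.b₁ Mstar * B₀) * c') ((1 - α') * r) U :=
  display348_of_local348_small285 𝔏 bI (walkCubeData39 bI) hG x hparS (hDD_walkCubeData39 bI x) hc' hr hrδ hα' hθ₀ hB₀
    walkCntY_nonneg hM hMbig (staticOK39Blk_cubeOps39YF_walk 𝔏 bI x hβ1 hMw) h261 hU hloc hsmall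

end WalkData

end Literature.MathematicalPhysics.QuantumFieldTheory.Balaban1983to89.B9Thm39CubeOpsWalkDataY

end
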